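import Summits.Ventures.Crystal3D.Bulk.GapCorners
import Literature.Geometry.DiscreteGeometry.SphericalCodeVertexStar
import HarnessLib

/-!
# The vertex star of the two-level tight graph: cyclic order of the tight partners, gap angles,
# `Σ gaps = 2π` (row R-sum), gap `=` corner, and every gap `< π` at a reduced extremal
# configuration (P-L2(a) in the LP's currency)

HONEST FRAMING. Part of the venture `Summits/Ventures/Crystal3D` (cell `pub-crystal3d`, phase 2,
24-hour sprint `PLAN.md` R42/R43; seat typer-bulk-2). The census LP (`TARGET-GAP.md` §4.5,
`phase2/ENV-CENSUS/DESIGN-L12-THEORY.md` §P-L4 B/C) works per VERTEX of the tight graph with the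
CYCLIC ORDER of its tight partners: the variables are the angles ("corners", "gaps") between
cyclically consecutive tight arcs, with rows R-sum (`Σ = 360°` at every non-rattler vertex), R-min
/ R-tri (bounds per corner) and "every corner `< 180°`" (P-L2(a)). The tree has this vertex-star
machinery at ONE contact level for Tammes configurations (`Literature…SphericalCodeVertexStar`:
`azimuth`, `tangentDir`, `sortedAngle`, `gapAngle`, `sum_gapAngle`, `gapAngle_lt_pi`,
Musin–Tarasov 2012 Prop. 3.6). THIS file is the TWO-LEVEL version for the fourteen-ball census
(partners of a shell ball at level `1/2`, the intruder at level `D/2`):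

* `tightNbrs c i` (the tight partners of ball `i`, the filter of the degree rows),
  `tightAzimuth c i j`, `tightAngles`, `sortedTightAngle`, `tightGap`, `tightNbrAt` — the cyclic
  (counter-clockwise) order of the tight partners of ball `i` around the direction `gapDir c i`
  and the gap angles between consecutive ones; `sum_tightGap` (**R-sum**: the gaps sum to `2π`),
  `tightGap_pos`;
* two-level azimuth algebra: `inner_eq_of_tightAzimuth` (`⟪u, u'⟫ = κκ' + √(1−κ²)√(1−κ'²)
  cos(θ − θ')`), `IsGapConfig.tightAzimuth_injOn` (distinct tight partners have distinct azimuths;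
  needs `D² < 3` for a shell partner against the intruder), `card_tightAngles`;
* `IsGapConfig.cos_tightGap_eq` and **`IsGapConfig.tightGap_eq_corner`**: a gap `≤ π` IS the
  corner `corner c i j j'` of `Bulk/GapCorners.lean` between the two consecutive partners — so
  the rows R-min / R-tri of that file apply to consecutive gaps verbatim;
* the bound "every gap `< π`" at a reduced extremal configuration (P-L2(a)) and the packaged
  vertex rows are in the sequel `Bulk/GapVertexStarBounds.lean`.

Nothing is claimed about GAP(1.26); faces (following consecutive darts from vertex to vertex)
are NOT constructed here.
-/

noncomputable section

open scoped BigOperators InnerProductSpace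
open Finset Real

namespace Summit.Ventures.Crystal3D

open Literature.Geometry.DiscreteGeometry

variable {c : Fin 14 → EuclideanSpace ℝ (Fin 3)}

/-! ## Tight partners and their azimuths around a ball -/

/-- The **tight partners** of ball `i`: the balls `j ∉ {0, i}` at distance exactly `1` from ball
`i` (shell contacts and, for a shell ball, possibly the intruder) — the finset whose cardinality
the degree rows of `Bulk/GapTightDegree.lean`, `Bulk/GapDegreesSharp.lean` bound. -/
def tightNbrs (c : Fin 14 → EuclideanSpace ℝ (Fin 3)) (i : Fin 14) : Finset (Fin 14) :=
  univ.filter fun j => j ≠ 0 ∧ j ≠ i ∧ dist (c i) (c j) = 1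

/-- Membership in `tightNbrs`. -/
theorem mem_tightNbrs {i j : Fin 14} : j ∈ tightNbrs c i ↔ j ≠ 0 ∧ j ≠ i ∧ dist (c i) (c j) = 1 := by
  simp [tightNbrs]

/-- The **azimuth** of ball `j` around ball `i`: the tangent angle of the direction `gapDir c j`
seen from the direction `gapDir c i`, in the tree's fixed tangent frame at `gapDir c i` (junk
value `0` if `gapDir c i` is not a unit vector, which does not happen for `i ≠ 0` in an admissible
configuration). -/
def tightAzimuth (c : Fin 14 → EuclideanSpace ℝ (Fin 3)) (i j : Fin 14) : ℝ :=
  if h : ‖gapDir c i‖ = 1 then azimuth (gapDir c i) h (gapDir c j) else 0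

/-- For an admissible configuration the azimuth is the tree's `azimuth`. -/
theorem IsGapConfig.tightAzimuth_eq (hc : IsGapConfig c) {i : Fin 14} (hi0 : i ≠ 0) (j : Fin 14) :
    tightAzimuth c i j = azimuth (gapDir c i) (hc.norm_gapDir hi0) (gapDir c j) := by
  unfold tightAzimuth
  rw [dif_pos (hc.norm_gapDir hi0)]

/-- `−π < azimuth ≤ π`. -/
theorem neg_pi_lt_tightAzimuth (c : Fin 14 → EuclideanSpace ℝ (Fin 3)) (i j : Fin 14) :
    -π < tightAzimuth c i j := by
  unfold tightAzimuth
  split_ifs with h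
  · exact neg_pi_lt_azimuth _ _ _
  · linarith [Real.pi_pos]

/-- `−π < azimuth ≤ π`. -/
theorem tightAzimuth_le_pi (c : Fin 14 → EuclideanSpace ℝ (Fin 3)) (i j : Fin 14) :
    tightAzimuth c i j ≤ π := by
  unfold tightAzimuth
  split_ifs with h
  · exact azimuth_le_pi _ _ _
  · linarith [Real.pi_pos]

/-- **Two-level azimuth formula.** Around a unit vector `v`, for unit `u, u'` at levels
`⟪v, u⟫ = κ`, `⟪v, u'⟫ = κ'`:  `⟪u, u'⟫ = κ κ' + √(1 − κ²) √(1 − κ'²) cos(θ − θ')` with `θ, θ'`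
their azimuths (the tree's `inner_eq_of_azimuth` is `κ = κ'`). -/
theorem inner_eq_of_azimuth_twoLevel {v : EuclideanSpace ℝ (Fin 3)} (hv : ‖v‖ = 1)
    {u u' : EuclideanSpace ℝ (Fin 3)} (hu : ‖u‖ = 1) (hu' : ‖u'‖ = 1) {κ κ' : ℝ}
    (hvu : ⟪v, u⟫_ℝ = κ) (hvu' : ⟪v, u'⟫_ℝ = κ') :
    ⟪u, u'⟫_ℝ = κ * κ' + √(1 - κ ^ 2) * √(1 - κ' ^ 2) *
      Real.cos (azimuth v hv u - azimuth v hv u') := by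
  have h := mul_add_mul_eq_sqrt_mul_sqrt_mul_cos (sq_add_sq_of_inner_eq (hv := hv) hu hvu)
    (sq_add_sq_of_inner_eq (hv := hv) hu' hvu')
  rw [inner_eq_sum_three (tangentFrame v hv), tangentFrame_two v hv, hvu, hvu']
  unfold azimuth
  linarith [h]

/-- The two-level azimuth formula for two balls `j, k` around ball `i` of an admissible
configuration: `⟪gapDir c j, gapDir c k⟫ = κκ' + √(1−κ²)√(1−κ'²) cos(θ_j − θ_k)` with
`κ = ⟪gapDir c i, gapDir c j⟫`, `κ' = ⟪gapDir c i, gapDir c k⟫`. -/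
theorem IsGapConfig.inner_eq_of_tightAzimuth (hc : IsGapConfig c) {i j k : Fin 14} (hi0 : i ≠ 0)
    (hj0 : j ≠ 0) (hk0 : k ≠ 0) :
    ⟪gapDir c j, gapDir c k⟫_ℝ =
      ⟪gapDir c i, gapDir c j⟫_ℝ * ⟪gapDir c i, gapDir c k⟫_ℝ +
        √(1 - ⟪gapDir c i, gapDir c j⟫_ℝ ^ 2) * √(1 - ⟪gapDir c i, gapDir c k⟫_ℝ ^ 2) *
          Real.cos (tightAzimuth c i j - tightAzimuth c i k) := by
  rw [hc.tightAzimuth_eq hi0, hc.tightAzimuth_eq hi0]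
  exact inner_eq_of_azimuth_twoLevel (hc.norm_gapDir hi0) (hc.norm_gapDir hj0)
    (hc.norm_gapDir hk0) rfl rfl

/-- **Distinct tight partners have distinct azimuths** (admissible configuration with
`intruderDist² < 3`). Two shell partners at the same azimuth would coincide (tree
`eq_of_azimuth_eq`, same level `1/2`); a shell partner and the intruder at the same azimuth would
be at inner product `D/4 + (√3/2)√(1 − D²/4) > D/2`, i.e. closer than allowed (`D² < 3`). -/
theorem IsGapConfig.tightAzimuth_injOn (hc : IsGapConfig c) (hD3 : intruderDist c ^ 2 < 3)
    {i : Fin 14} (hi0 : i ≠ 0) : Set.InjOn (tightAzimuth c i) (tightNbrs c i : Set (Fin 14)) := by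
  have hD1 := hc.one_le_intruderDist
  have hD2 : intruderDist c < 2 := by nlinarith
  intro j hj k hk hjk
  rw [Finset.mem_coe, mem_tightNbrs] at hj hk
  by_contra hne
  have hlevj := hc.inner_gapDir_eq hi0 hj.1 hj.2.2
  have hlevk := hc.inner_gapDir_eq hi0 hk.1 hk.2.2
  have hsep := hc.inner_gapDir_le hj.1 hk.1 hne
  have hform := hc.inner_eq_of_tightAzimuth hi0 hj.1 hk.1
  rw [hjk, sub_self, Real.cos_zero, mul_one, hlevj, hlevk] at hform
  -- case analysis on the levels
  by_cases hi13 : i = 13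
  · -- both partners are shell balls at level `D/2`: same level, tree lemma
    subst hi13
    have hj13 : j ≠ 13 := hj.2.1
    have hk13 : k ≠ 13 := hk.2.1
    rw [tightLevel_of_left] at hlevj hlevk
    have := eq_of_azimuth_eq (hv := hc.norm_gapDir hi0) (hc.norm_gapDir hj.1) (hc.norm_gapDir hk.1)
      hlevj hlevk (by rw [← hc.tightAzimuth_eq hi0, ← hc.tightAzimuth_eq hi0]; exact hjk)
    exact hc.gapDir_ne hD2 hj.1 hk.1 hne this
  by_cases hj13 : j = 13
  · subst hj13
    have hk13 : k ≠ 13 := fun h => hne (by rw [h])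
    rw [tightLevel_of_left] at hsep
    rw [hform, tightLevel_of_right, tightLevel_of_ne hi13 hk13] at hsep
    -- `D/2 · 1/2 + √(1 − D²/4) √(3/4) ≤ D/2` is impossible for `D² < 3`
    have h34 : √(1 - (1 / 2 : ℝ) ^ 2) = √3 / 2 := sqrt_one_sub_half_sq
    rw [h34, sqrt_one_sub_half_mul_sq] at hsep
    -- from hsep: √(4 - D²) · √3 ≤ D; square it
    have h1 : √(4 - intruderDist c ^ 2) * √3 ≤ intruderDist c := by linarith
    have h2 : (√(4 - intruderDist c ^ 2) * √3) ^ 2 ≤ intruderDist c ^ 2 :=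
      pow_le_pow_left₀ (by positivity) h1 2
    have h4 : (√(4 - intruderDist c ^ 2) * √3) ^ 2 = (4 - intruderDist c ^ 2) * 3 := by
      rw [mul_pow, Real.sq_sqrt (by nlinarith), Real.sq_sqrt (by norm_num)]
    rw [h4] at h2
    nlinarith [h2]
  by_cases hk13 : k = 13
  · subst hk13
    rw [tightLevel_of_right] at hsep
    rw [hform, tightLevel_of_ne hi13 hj13, tightLevel_of_right] at hsep
    have h34 : √(1 - (1 / 2 : ℝ) ^ 2) = √3 / 2 := sqrt_one_sub_half_sq
    rw [h34, sqrt_one_sub_half_mul_sq] at hsep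
    have h1 : √3 * √(4 - intruderDist c ^ 2) ≤ intruderDist c := by linarith
    have h2 : (√3 * √(4 - intruderDist c ^ 2)) ^ 2 ≤ intruderDist c ^ 2 :=
      pow_le_pow_left₀ (by positivity) h1 2
    have h4 : (√3 * √(4 - intruderDist c ^ 2)) ^ 2 = 3 * (4 - intruderDist c ^ 2) := by
      rw [mul_pow, Real.sq_sqrt (by norm_num), Real.sq_sqrt (by nlinarith)]
    rw [h4] at h2
    nlinarith [h2]
  · -- two shell partners at level `1/2`
    rw [tightLevel_of_ne hi13 hj13] at hlevj
    rw [tightLevel_of_ne hi13 hk13] at hlevk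
    have := eq_of_azimuth_eq (hv := hc.norm_gapDir hi0) (hc.norm_gapDir hj.1) (hc.norm_gapDir hk.1)
      hlevj hlevk (by rw [← hc.tightAzimuth_eq hi0, ← hc.tightAzimuth_eq hi0]; exact hjk)
    exact hc.gapDir_ne hD2 hj.1 hk.1 hne this

/-! ## The cyclic order of the tight partners and the gap angles -/

/-- The set of azimuths of the tight partners of ball `i`. -/
def tightAngles (c : Fin 14 → EuclideanSpace ℝ (Fin 3)) (i : Fin 14) : Finset ℝ :=
  (tightNbrs c i).image (tightAzimuth c i)

/-- There are exactly `deg(i)` distinct azimuths (admissible configuration, `D² < 3`). -/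
theorem IsGapConfig.card_tightAngles (hc : IsGapConfig c) (hD3 : intruderDist c ^ 2 < 3)
    {i : Fin 14} (hi0 : i ≠ 0) : (tightAngles c i).card = (tightNbrs c i).card :=
  Finset.card_image_of_injOn (hc.tightAzimuth_injOn hD3 hi0)

/-- **The sorted azimuths** `e₀ < e₁ < ⋯ < e_{d−1}` of the tight partners of ball `i`
(counter-clockwise order around `gapDir c i`). -/
def sortedTightAngle (c : Fin 14 → EuclideanSpace ℝ (Fin 3)) (i : Fin 14) {d : ℕ}
    (hd : (tightAngles c i).card = d) : Fin d ↪o ℝ :=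
  (tightAngles c i).orderEmbOfFin hd

/-- Each sorted azimuth is the azimuth of some tight partner. -/
theorem exists_eq_sortedTightAngle (c : Fin 14 → EuclideanSpace ℝ (Fin 3)) (i : Fin 14) {d : ℕ}
    (hd : (tightAngles c i).card = d) (m : Fin d) :
    ∃ j ∈ tightNbrs c i, tightAzimuth c i j = sortedTightAngle c i hd m := by
  have := (tightAngles c i).orderEmbOfFin_mem hd m
  unfold tightAngles at this
  rw [Finset.mem_image] at this
  obtain ⟨j, hj, he⟩ := this
  exact ⟨j, hj, he⟩

/-- Every tight partner's azimuth occurs in the sorted list. -/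
theorem exists_sortedTightAngle_eq (c : Fin 14 → EuclideanSpace ℝ (Fin 3)) (i : Fin 14) {d : ℕ}
    (hd : (tightAngles c i).card = d) {j : Fin 14} (hj : j ∈ tightNbrs c i) :
    ∃ m : Fin d, sortedTightAngle c i hd m = tightAzimuth c i j := by
  have hmem : tightAzimuth c i j ∈ tightAngles c i := Finset.mem_image_of_mem _ hj
  have hrange := (tightAngles c i).range_orderEmbOfFin hd
  have : tightAzimuth c i j ∈ Set.range ((tightAngles c i).orderEmbOfFin hd) := by
    rw [hrange]; exact hmem
  obtain ⟨m, hm⟩ := this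
  exact ⟨m, hm⟩

/-- Sorted azimuths lie in `(−π, π]`. -/
theorem sortedTightAngle_mem (c : Fin 14 → EuclideanSpace ℝ (Fin 3)) (i : Fin 14) {d : ℕ}
    (hd : (tightAngles c i).card = d) (m : Fin d) :
    -π < sortedTightAngle c i hd m ∧ sortedTightAngle c i hd m ≤ π := by
  obtain ⟨j, -, he⟩ := exists_eq_sortedTightAngle c i hd m
  rw [← he]
  exact ⟨neg_pi_lt_tightAzimuth c i j, tightAzimuth_le_pi c i j⟩

/-- **The gap angles** around ball `i`: `g_m = e_{m+1} − e_m` for `m < d − 1` and the wrap-around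
gap `g_{d−1} = 2π − (e_{d−1} − e₀)` — the angles between cyclically consecutive tight arcs at the
vertex `gapDir c i` of the tight graph (the LP's corner variables at that vertex). -/
def tightGap (c : Fin 14 → EuclideanSpace ℝ (Fin 3)) (i : Fin 14) {k : ℕ}
    (hd : (tightAngles c i).card = k + 1) (m : Fin (k + 1)) : ℝ :=
  sortedTightAngle c i hd (finRotate (k + 1) m) - sortedTightAngle c i hd m +
    if m = Fin.last k then 2 * π else 0

/-- **Row R-sum: the gaps around a vertex sum to `2π`.** -/
theorem sum_tightGap (c : Fin 14 → EuclideanSpace ℝ (Fin 3)) (i : Fin 14) {k : ℕ}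
    (hd : (tightAngles c i).card = k + 1) : ∑ m, tightGap c i hd m = 2 * π := by
  unfold tightGap
  rw [Finset.sum_add_distrib, Finset.sum_sub_distrib, Equiv.sum_comp (finRotate (k + 1))
    (fun m => sortedTightAngle c i hd m), sub_self, zero_add, Finset.sum_ite_eq']
  simp

/-- The cosine of a gap is the cosine of the difference of the two consecutive sorted azimuths. -/
theorem cos_tightGap (c : Fin 14 → EuclideanSpace ℝ (Fin 3)) (i : Fin 14) {k : ℕ}
    (hd : (tightAngles c i).card = k + 1) (m : Fin (k + 1)) :
    Real.cos (tightGap c i hd m) =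
      Real.cos (sortedTightAngle c i hd (finRotate (k + 1) m) - sortedTightAngle c i hd m) := by
  unfold tightGap
  split_ifs
  · rw [Real.cos_add_two_pi]
  · rw [add_zero]

/-- Every gap is positive and at most `2π`. -/
theorem tightGap_pos (c : Fin 14 → EuclideanSpace ℝ (Fin 3)) (i : Fin 14) {k : ℕ}
    (hd : (tightAngles c i).card = k + 1) (m : Fin (k + 1)) :
    0 < tightGap c i hd m ∧ tightGap c i hd m ≤ 2 * π := by
  have hmono := (sortedTightAngle c i hd).strictMono
  unfold tightGap
  by_cases hm : m = Fin.last k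
  · subst hm
    rw [if_pos rfl, finRotate_last]
    have h0 := (sortedTightAngle_mem c i hd 0).1
    have h1 := (sortedTightAngle_mem c i hd (Fin.last k)).2
    have hle : sortedTightAngle c i hd 0 ≤ sortedTightAngle c i hd (Fin.last k) :=
      hmono.monotone (Fin.zero_le _)
    constructor <;> linarith
  · rw [if_neg hm, add_zero, finRotate_apply]
    have hlt : m < Fin.last k := lt_of_le_of_ne (Fin.le_last m) hm
    have hlt' : m < m + 1 := Fin.lt_add_one_iff.2 hlt
    have h1 := hmono hlt'
    have h2 := (sortedTightAngle_mem c i hd m).1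
    have h3 := (sortedTightAngle_mem c i hd (m + 1)).2
    constructor <;> linarith

/-- **The tight partner at position `m`** in the counter-clockwise order around ball `i`. -/
def tightNbrAt (c : Fin 14 → EuclideanSpace ℝ (Fin 3)) (i : Fin 14) {d : ℕ}
    (hd : (tightAngles c i).card = d) (m : Fin d) : Fin 14 :=
  Classical.choose (exists_eq_sortedTightAngle c i hd m)

/-- It is a tight partner … -/
theorem tightNbrAt_mem (c : Fin 14 → EuclideanSpace ℝ (Fin 3)) (i : Fin 14) {d : ℕ}
    (hd : (tightAngles c i).card = d) (m : Fin d) : tightNbrAt c i hd m ∈ tightNbrs c i :=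
  (Classical.choose_spec (exists_eq_sortedTightAngle c i hd m)).1

/-- … whose azimuth is the `m`-th sorted azimuth. -/
theorem tightAzimuth_tightNbrAt (c : Fin 14 → EuclideanSpace ℝ (Fin 3)) (i : Fin 14) {d : ℕ}
    (hd : (tightAngles c i).card = d) (m : Fin d) :
    tightAzimuth c i (tightNbrAt c i hd m) = sortedTightAngle c i hd m :=
  (Classical.choose_spec (exists_eq_sortedTightAngle c i hd m)).2

/-- `tightNbrAt` is injective (the sorted azimuths are distinct). -/
theorem tightNbrAt_injective (c : Fin 14 → EuclideanSpace ℝ (Fin 3)) (i : Fin 14) {d : ℕ}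
    (hd : (tightAngles c i).card = d) : Function.Injective (tightNbrAt c i hd) := by
  intro m m' h
  have := congrArg (tightAzimuth c i) h
  rw [tightAzimuth_tightNbrAt, tightAzimuth_tightNbrAt] at this
  exact (sortedTightAngle c i hd).injective this

/-- Every tight partner is some `tightNbrAt m` (admissible configuration, `D² < 3`). -/
theorem IsGapConfig.exists_tightNbrAt_eq (hc : IsGapConfig c) (hD3 : intruderDist c ^ 2 < 3)
    {i : Fin 14} (hi0 : i ≠ 0) {d : ℕ} (hd : (tightAngles c i).card = d) {j : Fin 14}
    (hj : j ∈ tightNbrs c i) : ∃ m : Fin d, tightNbrAt c i hd m = j := by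
  obtain ⟨m, hm⟩ := exists_sortedTightAngle_eq c i hd hj
  exact ⟨m, hc.tightAzimuth_injOn hD3 hi0 (tightNbrAt_mem c i hd m) hj
    ((tightAzimuth_tightNbrAt c i hd m).trans hm)⟩

/-- Consecutive positions are distinct when there are at least two partners. -/
theorem finRotate_succ_ne {k : ℕ} (hk : k ≠ 0) (m : Fin (k + 1)) : finRotate (k + 1) m ≠ m := by
  intro h
  have h1 := congrArg Fin.val h
  rw [finRotate_apply] at h1
  by_cases hml : m = Fin.last k
  · rw [hml, Fin.last_add_one] at h1
    simp at h1
    exact hk h1.symm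
  · rw [Fin.val_add_one_of_lt (lt_of_le_of_ne (Fin.le_last m) hml)] at h1
    omega

/-! ## A gap is the corner between the two consecutive partners -/

/-- **The cosine of a gap in terms of the two consecutive partners** (two levels):
`cos g_m = (⟪u', u⟫ − κ'κ) / (√(1−κ'²) √(1−κ²))`, `u = gapDir c (tightNbrAt m)`,
`u' = gapDir c (tightNbrAt (m+1))`, `κ, κ'` their levels seen from `gapDir c i`. -/
theorem IsGapConfig.cos_tightGap_eq (hc : IsGapConfig c)
    {i : Fin 14} (hi0 : i ≠ 0) {k : ℕ} (hd : (tightAngles c i).card = k + 1) (m : Fin (k + 1)) :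
    Real.cos (tightGap c i hd m) *
        (√(1 - ⟪gapDir c i, gapDir c (tightNbrAt c i hd (finRotate (k + 1) m))⟫_ℝ ^ 2) *
          √(1 - ⟪gapDir c i, gapDir c (tightNbrAt c i hd m)⟫_ℝ ^ 2)) =
      ⟪gapDir c (tightNbrAt c i hd (finRotate (k + 1) m)), gapDir c (tightNbrAt c i hd m)⟫_ℝ -
        ⟪gapDir c i, gapDir c (tightNbrAt c i hd (finRotate (k + 1) m))⟫_ℝ *
          ⟪gapDir c i, gapDir c (tightNbrAt c i hd m)⟫_ℝ := by
  have hj := mem_tightNbrs.1 (tightNbrAt_mem c i hd (finRotate (k + 1) m))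
  have hj' := mem_tightNbrs.1 (tightNbrAt_mem c i hd m)
  have h := hc.inner_eq_of_tightAzimuth hi0 hj.1 hj'.1
  rw [tightAzimuth_tightNbrAt, tightAzimuth_tightNbrAt, ← cos_tightGap] at h
  linarith [h]

/-- Levels of tight partners are in `[1/2, 1)`: their squares are `< 1` (window `D < 2`). -/
theorem IsGapConfig.sq_inner_gapDir_lt_one (hc : IsGapConfig c) (hD : intruderDist c < 2)
    {i j : Fin 14} (hi0 : i ≠ 0) (hj : j ∈ tightNbrs c i) :
    ⟪gapDir c i, gapDir c j⟫_ℝ ^ 2 < 1 := by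
  obtain ⟨hj0, hji, hdij⟩ := mem_tightNbrs.1 hj
  rw [hc.inner_gapDir_eq hi0 hj0 hdij]
  have h1 := tightLevel_lt_one hD i j
  have h2 := hc.half_le_tightLevel i j
  nlinarith

/-- **A gap of at most `π` is the corner between its two partners**: `tightGap = corner c i j' j`
(`Bulk/GapCorners.lean`), `j = tightNbrAt m`, `j' = tightNbrAt (m+1)` — so the rows R-min / R-tri
of that file bound every such gap. (For `d ≥ 2`; with `D² < 3`.) -/
theorem IsGapConfig.tightGap_eq_corner (hc : IsGapConfig c) (hD3 : intruderDist c ^ 2 < 3)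
    {i : Fin 14} (hi0 : i ≠ 0) {k : ℕ} (hd : (tightAngles c i).card = k + 1) (m : Fin (k + 1))
    (hle : tightGap c i hd m ≤ π) :
    tightGap c i hd m =
      corner c i (tightNbrAt c i hd (finRotate (k + 1) m)) (tightNbrAt c i hd m) := by
  have hD1 := hc.one_le_intruderDist
  have hD2 : intruderDist c < 2 := by nlinarith
  have hcos := hc.cos_tightGap_eq hi0 hd m
  set j' := tightNbrAt c i hd (finRotate (k + 1) m) with hj'def
  set j := tightNbrAt c i hd m with hjdef
  have hjm : j ∈ tightNbrs c i := tightNbrAt_mem c i hd m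
  have hj'm : j' ∈ tightNbrs c i := tightNbrAt_mem c i hd (finRotate (k + 1) m)
  have hj0 := (mem_tightNbrs.1 hjm).1
  have hj'0 := (mem_tightNbrs.1 hj'm).1
  have hκ := hc.sq_inner_gapDir_lt_one hD2 hi0 hjm
  have hκ' := hc.sq_inner_gapDir_lt_one hD2 hi0 hj'm
  -- the corner is `arccos` of the normalised tangent inner product
  have hcorner : corner c i j' j =
      Real.arccos ((⟪gapDir c j', gapDir c j⟫_ℝ -
        ⟪gapDir c i, gapDir c j'⟫_ℝ * ⟪gapDir c i, gapDir c j⟫_ℝ) /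
        (√(1 - ⟪gapDir c i, gapDir c j'⟫_ℝ ^ 2) * √(1 - ⟪gapDir c i, gapDir c j⟫_ℝ ^ 2))) :=
    angle_tangentProj_eq_arccos (hc.norm_gapDir hi0) (hc.norm_gapDir hj'0) (hc.norm_gapDir hj0)
      rfl rfl rfl
  have hpos : 0 < √(1 - ⟪gapDir c i, gapDir c j'⟫_ℝ ^ 2) * √(1 - ⟪gapDir c i, gapDir c j⟫_ℝ ^ 2) :=
    mul_pos (Real.sqrt_pos.2 (by linarith)) (Real.sqrt_pos.2 (by linarith))
  rw [hcorner, ← hcos, mul_div_assoc, div_self hpos.ne', mul_one,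
    Real.arccos_cos (tightGap_pos c i hd m).1.le hle]


end Summit.Ventures.Crystal3D
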